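import Literature.NumberTheory.GaloisRepresentations.TateLevelOneRat
import Literature.NumberTheory.GaloisRepresentations.TateLevelOneWildTwo
import HarnessLib

/-!
# Tate's theorem `H²(G_ℚ, ℚ/ℤ) = 0` at level one, V′: the global character for `p = 2`
# (Serre, Durham 1977, §6.5 (d))

Sibling proof file (theorems only) of `TateProjectiveLifting.lean`: the case `p = 2` of
`rat_exists_character_levelOne` (`TateLevelOneRat.lean`), with the local datum at `2` supplied by
`TateLevelOneWildTwo.lean` (`N_2 = 4`, `s_2 = s₄`, `ψ₄ = s₄ ∘ χ_4` the character of `ℚ(i)`):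

* `rat_exists_character_levelOne_two` — for every locally constant `2`-torsion `2`-cocycle `g` on
  `Γ_ℚ` there are a locally constant (cyclotomic) character `φ : Γ_ℚ → ℚ/ℤ` and a locally
  constant cochain `c` with `2c = φ`, such that `g - ∂c` is, at every finite place `v`, the
  coboundary of a locally constant `2`-torsion cochain on `Γ_{ℚ_v}`.

(At the real place nothing is claimed: for `p = 2` the archimedean component is controlled in the
sequel through the Hasse principle over `ℚ(i)`.)

## References

* J.-P. Serre, *Modular forms of weight one and Galois representations* (Durham 1977), §6.5 (d).
  [SerreDurham1977]
-/

noncomputable section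

open Field ValuativeRel IsDedekindDomain NumberField Rat.HeightOneSpectrum
open scoped Pointwise NumberField

namespace Literature.NumberTheory.GaloisRepresentations

/-- **Serre's global character at level one, `p = 2`** (Durham §6.5 (d)): for every locally
constant `2`-torsion `2`-cocycle `g : Γ_ℚ × Γ_ℚ → ℚ/ℤ` there are a locally constant character
`φ` of `Γ_ℚ` and a locally constant cochain `c` with `2 c = φ` such that `g - ∂c` is, at every
finite place `v` of `ℚ`, the coboundary on `Γ_{ℚ_v}` of a locally constant `2`-torsion cochain.
[cite: SerreDurham1977, §6.5 (d)] -/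
theorem rat_exists_character_levelOne_two
    (g : absoluteGaloisGroup ℚ → absoluteGaloisGroup ℚ → AddCircle (1 : ℚ))
    (hg : IsLocallyConstant (Function.uncurry g))
    (hcoc : ∀ σ τ υ, g σ τ + g (σ * τ) υ = g τ υ + g σ (τ * υ)) (h2g : ∀ σ τ, 2 • g σ τ = 0) :
    ∃ (φ c : absoluteGaloisGroup ℚ → AddCircle (1 : ℚ)), IsLocallyConstant φ ∧
      (∀ σ τ, φ (σ * τ) = φ σ + φ τ) ∧ IsLocallyConstant c ∧ (∀ σ, 2 • c σ = φ σ) ∧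
      ∀ v : HeightOneSpectrum (𝓞 ℚ),
        ∃ β : absoluteGaloisGroup (v.adicCompletion ℚ) → AddCircle (1 : ℚ), IsLocallyConstant β ∧
          (∀ σ τ, (g (absGaloisRestrict ℚ (v.adicCompletion ℚ) σ)
              (absGaloisRestrict ℚ (v.adicCompletion ℚ) τ) -
            (c (absGaloisRestrict ℚ (v.adicCompletion ℚ) σ) +
              c (absGaloisRestrict ℚ (v.adicCompletion ℚ) τ) -
              c (absGaloisRestrict ℚ (v.adicCompletion ℚ) (σ * τ)))) + β (σ * τ) = β σ + β τ) ∧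
          ∀ σ, 2 • β σ = 0 :=
  rat_exists_character_levelOne Nat.prime_two (Np := 4) ⟨2, by norm_num⟩ signFour signFour_mul
    (fun v _ hv gv hgv hgv_coc hgv_2 =>
      adicCompletion_rat_twoCocycle_two_split_generator_form v hv gv hgv hgv_coc hgv_2)
    g hg hcoc h2g

end Literature.NumberTheory.GaloisRepresentations

end
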